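import Literature.Analysis.UnboundedOperators.MildFlowDerivativesCurve
import HarnessLib

/-!
# Joint continuity in `(t, y)` of the first and second `y`-derivatives of a family of mild solutions

Analysis/UnboundedOperators support file (theorems only, everything proved, no named facts, no
definitions).  Setting of the sibling `MildFlowDerivativesCurve.lean`: a real Banach space `E`,
strongly continuous contractions `T(t)` which are norm continuous on `(0, ∞)`, a weakly singular family
`K(t)` (`‖K(t)‖ ≤ C t^{-α}`, `0 ≤ α < 1`), strongly and norm continuous on `(0, ∞)` (the abstract
`e^{-tA}`, `A^α e^{-tA}` of an analytic semigroup: D. Henry, *Geometric Theory of Semilinear Parabolic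
Equations*, LNM 840 (1981), Thm 1.4.3), a bounded bilinear `N`, a constant forcing `f`, `L > 0`, and a
family `G : E → C([0, L]; E)` of mild solutions

  `G y (t) = T(t) y + ∫₀ᵗ T(t − s) f ds − ∫₀ᵗ K(t − s) N(G y (s), G y (s)) ds`     (`y ∈ U` open),

continuous on `U`.  By `contDiffOn_of_mild` the family is `C^∞` in `y` as curves; here we prove
(`continuousOn_fderiv_mildFlow`, Henry 1981, Thm 3.4.4 and Cor. 3.4.6 with the norm continuity of the
evolution operators for `t > 0`, §7.1):

1. the first derivative field `W(t, y) = D_y [G y (t)] ∈ L(E)` is continuous on `(0, L] × U` in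
   OPERATOR norm;
2. so is the second derivative field `W₂(t, y) = D_y W(t, y) ∈ L(E, L(E))`;
3. for `y ∈ U`, `h ∈ E` the curve `t ↦ W(t, y) h` is continuous on `[0, L]` and solves the linearised
   mild equation `w(t) = T(t) h − ∫₀ᵗ K(t − s) (N(y(s), w(s)) + N(w(s), y(s))) ds` along `y = G y`.

Proof.  Per time, `D_y [G y (t)] = ev_t ∘ DG(y)` and `D_y² [G y (t)] = Λ_t ∘ D²G(y)`, `Λ_t Z = ev_t ∘ Z`
(chain rule through the evaluation functional; `fderiv_apply_eq_evalCLM_comp`,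
`fderiv_fderiv_apply_eq_comp`), so 3 is the first variation `fderiv_mildFlow_apply` read at time `t`.
For 1 and 2 split `W(t, y) − W(t₀, y₀) = ev_t ∘ (DG(y) − DG(y₀)) + (W(t, y₀) − W(t₀, y₀))`
(`continuousOn_prod_of_norm_sub_le`, `‖ev_t‖ ≤ 1`): the first term is small by the continuity of
`y ↦ DG(y)`, `y ↦ D²G(y)` (`C^∞`), and the second is the continuity of `t ↦ W(t, y₀)`, `t ↦ W₂(t, y₀)` in
operator norm, i.e. equicontinuity in `t` of the curves `DG(y₀) h`, `D²G(y₀)[k] h` over unit `h, k`: by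
the first / second variation these are Duhamel integrals `T(t) h − ∫₀ᵗ K(t − s) g_h(s) ds`,
`−∫₀ᵗ K(t − s) g_{k,h}(s) ds` with `‖g_h‖ ≤ M₀ ‖h‖`, `‖g_{k,h}‖ ≤ M₀ ‖k‖ ‖h‖`, to which the
uniform-in-`g` time modulus of the weakly singular Duhamel integral for a norm-continuous kernel applies
(`continuousOn_Ioc_of_eq_duhamel`, `exists_forall_norm_integral_duhamel_sub_le` of
`LinearMildFlowSmall.lean` / `LinearMildFlowKernelContinuity.lean`; for `t > 0` because of `T(t) h`).

## References

* D. Henry, *Geometric Theory of Semilinear Parabolic Equations*, LNM 840, Springer (1981), Thm 1.4.3,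
  Thm 3.4.4, Cor. 3.4.6, §7.1 (Lemma 7.1.1, Thm 7.1.3). [Henry1981]
* A. Pazy, *Semigroups of Linear Operators and Applications to Partial Differential Equations*,
  Springer (1983), Thm 2.6.13, §6.3 Thm 6.3.1. [Pazy1983]
-/

noncomputable section

open MeasureTheory Set Filter intervalIntegral
open _root_.Topology
open scoped ContDiff

namespace Literature.Analysis.UnboundedOperators

-- operator norms on the doubly nested `E →L (E →L C([0, L]; E))` (second derivatives of curve-valued maps)
-- need one more level of pending instance problems than the default
set_option maxSynthPendingDepth 3

section Evaluation

variable {E F F' : Type*} [NormedAddCommGroup E] [NormedSpace ℝ E] [NormedAddCommGroup F]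
  [NormedSpace ℝ F] [NormedAddCommGroup F'] [NormedSpace ℝ F']

omit [NormedSpace ℝ E] [NormedSpace ℝ F] [NormedSpace ℝ F'] in
/-- **Joint continuity from continuity in each variable, one of them uniform**: if every `Λ t` is
`1`-Lipschitz, `y ↦ D y` is continuous on `U` and `t ↦ Λ t (D y)` is continuous on `S` for every `y ∈ U`,
then `(t, y) ↦ Λ t (D y)` is continuous on `S × U`
(`Λ t (D y) − Λ t₀ (D y₀) = (Λ t (D y) − Λ t (D y₀)) + (Λ t (D y₀) − Λ t₀ (D y₀))`). [folklore] -/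
theorem continuousOn_prod_of_norm_sub_le {S : Set ℝ} {U : Set E} (Λ : ℝ → F' → F)
    (hΛ : ∀ t z z', ‖Λ t z - Λ t z'‖ ≤ ‖z - z'‖) {D : E → F'} (hD : ContinuousOn D U)
    (ht : ∀ y ∈ U, ContinuousOn (fun t => Λ t (D y)) S) :
    ContinuousOn (fun q : ℝ × E => Λ q.1 (D q.2)) (S ×ˢ U) := by
  intro q₀ hq₀
  have hA : ContinuousWithinAt (fun q : ℝ × E => D q.2) (S ×ˢ U) q₀ :=
    (hD q₀.2 hq₀.2).comp continuousWithinAt_snd fun q hq => hq.2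
  have hB : ContinuousWithinAt (fun q : ℝ × E => Λ q.1 (D q₀.2)) (S ×ˢ U) q₀ :=
    (ht q₀.2 hq₀.2 q₀.1 hq₀.1).comp continuousWithinAt_fst fun q hq => hq.1
  rw [ContinuousWithinAt, tendsto_iff_norm_sub_tendsto_zero] at hA hB ⊢
  refine squeeze_zero (g := fun q : ℝ × E => ‖D q.2 - D q₀.2‖ + ‖Λ q.1 (D q₀.2) - Λ q₀.1 (D q₀.2)‖)
    (fun q => norm_nonneg _) (fun q => ?_) (by simpa using hA.add hB)
  calc ‖Λ q.1 (D q.2) - Λ q₀.1 (D q₀.2)‖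
      = ‖(Λ q.1 (D q.2) - Λ q.1 (D q₀.2)) + (Λ q.1 (D q₀.2) - Λ q₀.1 (D q₀.2))‖ := by
        rw [sub_add_sub_cancel]
    _ ≤ ‖Λ q.1 (D q.2) - Λ q.1 (D q₀.2)‖ + ‖Λ q.1 (D q₀.2) - Λ q₀.1 (D q₀.2)‖ := norm_add_le _ _
    _ ≤ ‖D q.2 - D q₀.2‖ + ‖Λ q.1 (D q₀.2) - Λ q₀.1 (D q₀.2)‖ := add_le_add (hΛ _ _ _) le_rfl

variable {S : Type*} [TopologicalSpace S] [CompactSpace S]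

/-- `‖ev_t ∘ W‖ ≤ ‖W‖` for `W : E →L C(S; F)`: the evaluation functional has norm `≤ 1`. [folklore] -/
theorem norm_evalCLM_comp_le (t : S) (W : E →L[ℝ] C(S, F)) :
    ‖(ContinuousMap.evalCLM ℝ t).comp W‖ ≤ ‖W‖ :=
  ContinuousLinearMap.opNorm_le_bound _ (norm_nonneg W) fun h =>
    ((W h).norm_coe_le_norm t).trans (W.le_opNorm h)

/-- `‖Λ_t ∘ Z‖ ≤ ‖Z‖` for `Z : E →L (E →L C(S; F))` and the post-composition `Λ_t` with `ev_t`. [folklore] -/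
theorem norm_compL_evalCLM_comp_le (t : S) (Z : E →L[ℝ] E →L[ℝ] C(S, F)) :
    ‖(ContinuousLinearMap.compL ℝ E C(S, F) F (ContinuousMap.evalCLM ℝ t)).comp Z‖ ≤ ‖Z‖ :=
  ContinuousLinearMap.opNorm_le_bound _ (norm_nonneg Z) fun k => by
    rw [ContinuousLinearMap.comp_apply, ContinuousLinearMap.compL_apply]
    exact (norm_evalCLM_comp_le t (Z k)).trans (Z.le_opNorm k)

/-- **The `y`-derivative of a curve-valued map at a fixed time**: if `G : E → C(S; F)` is differentiable
at `y` then `D(G · t)(y) = ev_t ∘ DG(y)` (chain rule through the evaluation functional). [folklore] -/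
theorem fderiv_apply_eq_evalCLM_comp {G : E → C(S, F)} {y : E} (hG : DifferentiableAt ℝ G y) (t : S) :
    fderiv ℝ (fun y' => G y' t) y = (ContinuousMap.evalCLM ℝ t).comp (fderiv ℝ G y) := by
  rw [show (fun y' => G y' t) = ⇑(ContinuousMap.evalCLM ℝ t) ∘ G from rfl]
  exact ((ContinuousMap.evalCLM ℝ t).hasFDerivAt.comp y hG.hasFDerivAt).fderiv

/-- **The second `y`-derivative at a fixed time**: if `G : E → C(S; F)` is `C^∞` on an open `U` then for
`y ∈ U`, `D²(G · t)(y) = Λ_t ∘ D²G(y)` with `Λ_t Z = ev_t ∘ Z` (the first-order formula holds near `y`;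
differentiate it). [folklore] -/
theorem fderiv_fderiv_apply_eq_comp {G : E → C(S, F)} {U : Set E} (hU : IsOpen U)
    (hG : ContDiffOn ℝ ∞ G U) {y : E} (hy : y ∈ U) (t : S) :
    fderiv ℝ (fun y' => fderiv ℝ (fun y'' => G y'' t) y') y =
      (ContinuousLinearMap.compL ℝ E C(S, F) F (ContinuousMap.evalCLM ℝ t)).comp
        (fderiv ℝ (fderiv ℝ G) y) := by
  have hsmooth : ContDiffAt ℝ ∞ G y := hG.contDiffAt (hU.mem_nhds hy)
  have hD : HasFDerivAt (fderiv ℝ G) (fderiv ℝ (fderiv ℝ G) y) y :=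
    ((hsmooth.fderiv_right (m := ∞) ENat.coe_top_add_one.le).differentiableAt (by simp)).hasFDerivAt
  have hev : (fun y' => fderiv ℝ (fun y'' => G y'' t) y') =ᶠ[𝓝 y]
      ⇑(ContinuousLinearMap.compL ℝ E C(S, F) F (ContinuousMap.evalCLM ℝ t)) ∘ fderiv ℝ G := by
    filter_upwards [hU.mem_nhds hy] with y' hy'
    rw [fderiv_apply_eq_evalCLM_comp ((hG.contDiffAt (hU.mem_nhds hy')).differentiableAt (by simp)) t,
      Function.comp_apply, ContinuousLinearMap.compL_apply]
  rw [hev.fderiv_eq]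
  exact ((ContinuousLinearMap.compL ℝ E C(S, F) F (ContinuousMap.evalCLM ℝ t)).hasFDerivAt.comp y
    hD).fderiv

end Evaluation

variable {E : Type*} [NormedAddCommGroup E] [NormedSpace ℝ E] [CompleteSpace E]

/-- **Joint continuity of the `y`-derivatives of a family of mild solutions** (Henry 1981, Thm 3.4.4 and
Cor. 3.4.6, with the norm continuity of the evolution operators for `t > 0`, §7.1).  Let `T(t)` be
strongly continuous contractions, norm continuous on `(0, ∞)`, `K(t)` strongly and norm continuous on
`(0, ∞)` with `‖K(t)‖ ≤ C t^{-α}` (`C ≥ 0`, `0 ≤ α < 1`), `N` bounded bilinear, `f ∈ E`, `L > 0`, and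
`G : E → C([0, L]; E)` continuous on an open `U` with `G y` the mild solution of
`y(t) = T(t) y + ∫₀ᵗ T(t − s) f ds − ∫₀ᵗ K(t − s) N(y(s), y(s)) ds` from `y` for every `y ∈ U`.  Then:
`(t, y) ↦ D_y[G y (t)]` and `(t, y) ↦ D_y²[G y (t)]` are continuous on `(0, L] × U` in operator norm; and
for `y ∈ U`, `h ∈ E` the curve `w(t) = D_y[G y (t)] h` is continuous on `[0, L]` and solves the
linearised mild equation `w(t) = T(t) h − ∫₀ᵗ K(t − s) (N(y(s), w(s)) + N(w(s), y(s))) ds` along `G y`.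
[cite: Henry1981, Thm 3.4.4 and Cor. 3.4.6] -/
theorem continuousOn_fderiv_mildFlow (T K : ℝ → E →L[ℝ] E) (hTnorm : ∀ t, 0 ≤ t → ‖T t‖ ≤ 1)
    (hTc : ∀ y : E, Continuous fun t : ℝ => T t y) (hTn : ContinuousOn T (Ioi 0)) {α C : ℝ}
    (hα₀ : 0 ≤ α) (hα : α < 1) (hC : 0 ≤ C) (hK : ∀ t, 0 < t → ‖K t‖ ≤ C * t ^ (-α))
    (hKc : ∀ y : E, ContinuousOn (fun t : ℝ => K t y) (Ioi 0)) (hKn : ContinuousOn K (Ioi 0))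
    (N : E →L[ℝ] E →L[ℝ] E) (f : E) {L : ℝ} (hL : 0 < L) {U : Set E} (hU : IsOpen U)
    (G : E → C(Icc (0 : ℝ) L, E)) (hGc : ContinuousOn G U)
    (hGm : ∀ y ∈ U, ∀ t : Icc (0 : ℝ) L, G y t = T t y + (∫ s in (0 : ℝ)..(t : ℝ), T ((t : ℝ) - s) f) -
      ∫ s in (0 : ℝ)..(t : ℝ), K ((t : ℝ) - s)
        (N (G y (Set.projIcc 0 L hL.le s)) (G y (Set.projIcc 0 L hL.le s)))) :
    ContinuousOn (fun q : ℝ × E => fderiv ℝ (fun y => G y (Set.projIcc 0 L hL.le q.1)) q.2)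
      (Ioc 0 L ×ˢ U) ∧
    ContinuousOn (fun q : ℝ × E =>
      fderiv ℝ (fun y => fderiv ℝ (fun y' => G y' (Set.projIcc 0 L hL.le q.1)) y) q.2) (Ioc 0 L ×ˢ U) ∧
    (∀ y ∈ U, ∀ h : E, Continuous (fun t : Icc (0 : ℝ) L => fderiv ℝ (fun y' => G y' t) y h) ∧
      ∀ t : Icc (0 : ℝ) L, fderiv ℝ (fun y' => G y' t) y h = T t h -
        ∫ s in (0 : ℝ)..(t : ℝ), K ((t : ℝ) - s)
          (N (G y (Set.projIcc 0 L hL.le s)) (fderiv ℝ (fun y' => G y' (Set.projIcc 0 L hL.le s)) y h) +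
            N (fderiv ℝ (fun y' => G y' (Set.projIcc 0 L hL.le s)) y h)
              (G y (Set.projIcc 0 L hL.le s)))) := by
  -- ### curve-level smoothness and the two variations
  have hG : ContDiffOn ℝ ∞ G U := contDiffOn_of_mild T K hTnorm hTc hα₀ hα hC hK hKc N f hL hU hGc hGm
  have hb := fun y (hy : y ∈ U) =>
    fderiv_mildFlow_apply T K hTnorm hTc hα₀ hα hC hK hKc N f hL hU hGc hGm hy
  have hc := fun y (hy : y ∈ U) =>
    fderiv_fderiv_mildFlow_apply T K hTnorm hTc hα₀ hα hC hK hKc N f hL hU hGc hGm hy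
  have hGd : ∀ y ∈ U, DifferentiableAt ℝ G y := fun y hy =>
    (hG.contDiffAt (hU.mem_nhds hy)).differentiableAt (by simp)
  have hD1c : ContinuousOn (fderiv ℝ G) U := hG.continuousOn_fderiv_of_isOpen hU (by simp)
  have hD2c : ContinuousOn (fderiv ℝ (fderiv ℝ G)) U :=
    (hG.fderiv_of_isOpen hU ENat.coe_top_add_one.le).continuousOn_fderiv_of_isOpen hU (by simp)
  -- per-time first derivative
  have h1 : ∀ y ∈ U, ∀ (t : Icc (0 : ℝ) L) (h : E), fderiv ℝ (fun y' => G y' t) y h = fderiv ℝ G y h t :=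
    fun y hy t h => by rw [fderiv_apply_eq_evalCLM_comp (hGd y hy) t]; rfl
  -- ### the evaluation operators `Λ₁ t Z = ev_t ∘ Z`, `Λ₂ t Z = Λ₁ t ∘ Z` (time clamped to `[0, L]`)
  obtain ⟨Λ₁, hΛ₁⟩ : ∃ Λ₁ : ℝ → (E →L[ℝ] C(Icc (0 : ℝ) L, E)) → (E →L[ℝ] E), ∀ t Z,
      Λ₁ t Z = (ContinuousMap.evalCLM ℝ (Set.projIcc 0 L hL.le t)).comp Z := ⟨_, fun _ _ => rfl⟩
  obtain ⟨Λ₂, hΛ₂⟩ : ∃ Λ₂ : ℝ → (E →L[ℝ] E →L[ℝ] C(Icc (0 : ℝ) L, E)) → (E →L[ℝ] E →L[ℝ] E), ∀ t Z,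
      Λ₂ t Z = (ContinuousLinearMap.compL ℝ E C(Icc (0 : ℝ) L, E) E
        (ContinuousMap.evalCLM ℝ (Set.projIcc 0 L hL.le t))).comp Z := ⟨_, fun _ _ => rfl⟩
  have hΛ₁ap : ∀ (t : ℝ) (Z : E →L[ℝ] C(Icc (0 : ℝ) L, E)) (h : E),
      Λ₁ t Z h = Z h (Set.projIcc 0 L hL.le t) := fun t Z h => by
    rw [hΛ₁, ContinuousLinearMap.comp_apply, ContinuousMap.evalCLM_apply]
  have hΛ₂ap : ∀ (t : ℝ) (Z : E →L[ℝ] E →L[ℝ] C(Icc (0 : ℝ) L, E)) (k h : E),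
      Λ₂ t Z k h = Z k h (Set.projIcc 0 L hL.le t) := fun t Z k h => by
    rw [hΛ₂, ContinuousLinearMap.comp_apply, ContinuousLinearMap.compL_apply,
      ContinuousLinearMap.comp_apply, ContinuousMap.evalCLM_apply]
  have hΛ₁n : ∀ t Z Z', ‖Λ₁ t Z - Λ₁ t Z'‖ ≤ ‖Z - Z'‖ := fun t Z Z' => by
    rw [hΛ₁, hΛ₁, ← ContinuousLinearMap.comp_sub]
    exact norm_evalCLM_comp_le _ _
  have hΛ₂n : ∀ t Z Z', ‖Λ₂ t Z - Λ₂ t Z'‖ ≤ ‖Z - Z'‖ := fun t Z Z' => by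
    rw [hΛ₂, hΛ₂, ← ContinuousLinearMap.comp_sub]
    exact norm_compL_evalCLM_comp_le _ _
  -- ### norm continuity in `t` of the first derivative field at a fixed `y`, on `(0, L]`
  have ht1 : ∀ y ∈ U, ContinuousOn (fun t => Λ₁ t (fderiv ℝ G y)) (Ioc 0 L) := by
    intro y hy
    have hgc : ∀ h : E, Continuous fun s : ℝ =>
        N (G y (Set.projIcc 0 L hL.le s)) (fderiv ℝ G y h (Set.projIcc 0 L hL.le s)) +
          N (fderiv ℝ G y h (Set.projIcc 0 L hL.le s)) (G y (Set.projIcc 0 L hL.le s)) := fun h =>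
      ((N.continuous.comp ((G y).continuous.comp continuous_projIcc)).clm_apply
        ((fderiv ℝ G y h).continuous.comp continuous_projIcc)).add
        ((N.continuous.comp ((fderiv ℝ G y h).continuous.comp continuous_projIcc)).clm_apply
          ((G y).continuous.comp continuous_projIcc))
    refine continuousOn_Ioc_of_eq_duhamel (T := T) (K := K)
      (M₀ := 2 * ‖N‖ * ‖G y‖ * ‖fderiv ℝ G y‖)
      (g := fun h s => N (G y (Set.projIcc 0 L hL.le s)) (fderiv ℝ G y h (Set.projIcc 0 L hL.le s)) +
        N (fderiv ℝ G y h (Set.projIcc 0 L hL.le s)) (G y (Set.projIcc 0 L hL.le s)))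
      hTn hα₀ hα hC hK hKn (by positivity) hgc (fun h s => ?_) (fun h t ht => ?_)
    · have ha : ‖G y (Set.projIcc 0 L hL.le s)‖ ≤ ‖G y‖ := (G y).norm_coe_le_norm _
      have hw : ‖fderiv ℝ G y h (Set.projIcc 0 L hL.le s)‖ ≤ ‖fderiv ℝ G y‖ * ‖h‖ :=
        ((fderiv ℝ G y h).norm_coe_le_norm _).trans ((fderiv ℝ G y).le_opNorm h)
      calc ‖N (G y (Set.projIcc 0 L hL.le s)) (fderiv ℝ G y h (Set.projIcc 0 L hL.le s)) +
            N (fderiv ℝ G y h (Set.projIcc 0 L hL.le s)) (G y (Set.projIcc 0 L hL.le s))‖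
          ≤ ‖N‖ * ‖G y (Set.projIcc 0 L hL.le s)‖ * ‖fderiv ℝ G y h (Set.projIcc 0 L hL.le s)‖ +
              ‖N‖ * ‖fderiv ℝ G y h (Set.projIcc 0 L hL.le s)‖ * ‖G y (Set.projIcc 0 L hL.le s)‖ :=
            (norm_add_le _ _).trans (add_le_add (N.le_opNorm₂ _ _) (N.le_opNorm₂ _ _))
        _ ≤ ‖N‖ * ‖G y‖ * (‖fderiv ℝ G y‖ * ‖h‖) + ‖N‖ * (‖fderiv ℝ G y‖ * ‖h‖) * ‖G y‖ := by
            gcongr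
        _ = 2 * ‖N‖ * ‖G y‖ * ‖fderiv ℝ G y‖ * ‖h‖ := by ring
    · rw [hΛ₁ap, Set.projIcc_of_mem hL.le ht]
      exact hb y hy h ⟨t, ht⟩
  -- ### norm continuity in `t` of the second derivative field at a fixed `y`, on `[0, L]`
  have ht2 : ∀ y ∈ U, ContinuousOn (fun t => Λ₂ t (fderiv ℝ (fderiv ℝ G) y)) (Icc 0 L) := by
    intro y hy t₀ ht₀
    rw [Metric.continuousWithinAt_iff]
    intro ε hε
    set M₀ : ℝ := 2 * ‖N‖ * ‖fderiv ℝ G y‖ * ‖fderiv ℝ G y‖ +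
      2 * ‖N‖ * ‖G y‖ * ‖fderiv ℝ (fderiv ℝ G) y‖ with hM₀
    have hM₀0 : 0 ≤ M₀ := by positivity
    obtain ⟨δ, hδ, hmod⟩ := exists_forall_norm_integral_duhamel_sub_le (E := E) hα₀ hα hC hK hKn ht₀.1
      (ε := ε / (2 * (M₀ + 1))) (by positivity)
    refine ⟨δ, hδ, fun t ht htd => ?_⟩
    rw [dist_eq_norm]
    -- the source `g_{k,h}` of the second variation: continuity and the bound `M₀ ‖k‖ ‖h‖`
    set g : E → E → ℝ → E := fun k h s =>
      N (fderiv ℝ G y k (Set.projIcc 0 L hL.le s)) (fderiv ℝ G y h (Set.projIcc 0 L hL.le s)) +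
        N (G y (Set.projIcc 0 L hL.le s)) (fderiv ℝ (fderiv ℝ G) y k h (Set.projIcc 0 L hL.le s)) +
        N (fderiv ℝ (fderiv ℝ G) y k h (Set.projIcc 0 L hL.le s)) (G y (Set.projIcc 0 L hL.le s)) +
        N (fderiv ℝ G y h (Set.projIcc 0 L hL.le s)) (fderiv ℝ G y k (Set.projIcc 0 L hL.le s)) with hg
    have hgc : ∀ k h, Continuous (g k h) := fun k h => by
      have hcy : Continuous fun s : ℝ => G y (Set.projIcc 0 L hL.le s) :=
        (G y).continuous.comp continuous_projIcc
      have hcw : ∀ h : E, Continuous fun s : ℝ => fderiv ℝ G y h (Set.projIcc 0 L hL.le s) := fun h =>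
        (fderiv ℝ G y h).continuous.comp continuous_projIcc
      have hcv : Continuous fun s : ℝ => fderiv ℝ (fderiv ℝ G) y k h (Set.projIcc 0 L hL.le s) :=
        (fderiv ℝ (fderiv ℝ G) y k h).continuous.comp continuous_projIcc
      exact ((((N.continuous.comp (hcw k)).clm_apply (hcw h)).add
        ((N.continuous.comp hcy).clm_apply hcv)).add ((N.continuous.comp hcv).clm_apply hcy)).add
        ((N.continuous.comp (hcw h)).clm_apply (hcw k))
    have hgb : ∀ k h s, ‖g k h s‖ ≤ M₀ * ‖k‖ * ‖h‖ := fun k h s => by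
      have ha : ‖G y (Set.projIcc 0 L hL.le s)‖ ≤ ‖G y‖ := (G y).norm_coe_le_norm _
      have hw : ∀ h : E, ‖fderiv ℝ G y h (Set.projIcc 0 L hL.le s)‖ ≤ ‖fderiv ℝ G y‖ * ‖h‖ := fun h =>
        ((fderiv ℝ G y h).norm_coe_le_norm _).trans ((fderiv ℝ G y).le_opNorm h)
      have hv : ‖fderiv ℝ (fderiv ℝ G) y k h (Set.projIcc 0 L hL.le s)‖ ≤
          ‖fderiv ℝ (fderiv ℝ G) y‖ * ‖k‖ * ‖h‖ :=
        ((fderiv ℝ (fderiv ℝ G) y k h).norm_coe_le_norm _).trans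
          (((fderiv ℝ (fderiv ℝ G) y k).le_opNorm h).trans (mul_le_mul_of_nonneg_right
            ((fderiv ℝ (fderiv ℝ G) y).le_opNorm k) (norm_nonneg h)))
      calc ‖g k h s‖ ≤ ‖N‖ * ‖fderiv ℝ G y k (Set.projIcc 0 L hL.le s)‖ *
              ‖fderiv ℝ G y h (Set.projIcc 0 L hL.le s)‖ +
            ‖N‖ * ‖G y (Set.projIcc 0 L hL.le s)‖ *
              ‖fderiv ℝ (fderiv ℝ G) y k h (Set.projIcc 0 L hL.le s)‖ +
            ‖N‖ * ‖fderiv ℝ (fderiv ℝ G) y k h (Set.projIcc 0 L hL.le s)‖ *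
              ‖G y (Set.projIcc 0 L hL.le s)‖ +
            ‖N‖ * ‖fderiv ℝ G y h (Set.projIcc 0 L hL.le s)‖ *
              ‖fderiv ℝ G y k (Set.projIcc 0 L hL.le s)‖ :=
            norm_add₃_le.trans (add_le_add (add_le_add ((norm_add_le _ _).trans
              (add_le_add (N.le_opNorm₂ _ _) (N.le_opNorm₂ _ _))) (N.le_opNorm₂ _ _)) (N.le_opNorm₂ _ _))
        _ ≤ ‖N‖ * (‖fderiv ℝ G y‖ * ‖k‖) * (‖fderiv ℝ G y‖ * ‖h‖) +
            ‖N‖ * ‖G y‖ * (‖fderiv ℝ (fderiv ℝ G) y‖ * ‖k‖ * ‖h‖) +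
            ‖N‖ * (‖fderiv ℝ (fderiv ℝ G) y‖ * ‖k‖ * ‖h‖) * ‖G y‖ +
            ‖N‖ * (‖fderiv ℝ G y‖ * ‖h‖) * (‖fderiv ℝ G y‖ * ‖k‖) := by
            gcongr
            · exact hw k
            · exact hw h
            · exact hw h
            · exact hw k
        _ = M₀ * ‖k‖ * ‖h‖ := by rw [hM₀]; ring
    -- the second variation at the times `t`, `t₀`
    have hval : ∀ (r : ℝ) (hr : r ∈ Icc 0 L) (k h : E), Λ₂ r (fderiv ℝ (fderiv ℝ G) y) k h =
        -∫ s in (0 : ℝ)..r, K (r - s) (g k h s) := fun r hr k h => by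
      rw [hΛ₂ap, Set.projIcc_of_mem hL.le hr]
      exact hc y hy k h ⟨r, hr⟩
    have hle : ‖Λ₂ t (fderiv ℝ (fderiv ℝ G) y) - Λ₂ t₀ (fderiv ℝ (fderiv ℝ G) y)‖ ≤ ε / 2 := by
      refine ContinuousLinearMap.opNorm_le_bound _ (by positivity) fun k => ?_
      refine ContinuousLinearMap.opNorm_le_bound _ (by positivity) fun h => ?_
      rw [sub_apply, sub_apply, hval t ht k h, hval t₀ ht₀ k h, neg_sub_neg, norm_sub_rev]
      have hd : |t - t₀| < δ := by rw [← Real.dist_eq]; exact htd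
      calc ‖(∫ s in (0 : ℝ)..t, K (t - s) (g k h s)) - ∫ s in (0 : ℝ)..t₀, K (t₀ - s) (g k h s)‖
          ≤ ε / (2 * (M₀ + 1)) * (M₀ * ‖k‖ * ‖h‖) := hmod t ht.1 hd (g k h) _ (hgc k h) (hgb k h)
        _ ≤ ε / 2 * ‖k‖ * ‖h‖ := by
            rw [div_mul_eq_mul_div, div_le_iff₀ (by positivity : (0 : ℝ) < 2 * (M₀ + 1))]
            have h0 : 0 ≤ ε * ‖k‖ * ‖h‖ := by positivity
            nlinarith [h0, hM₀0]
    exact hle.trans_lt (half_lt_self hε)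
  -- ### the three conclusions
  refine ⟨?_, ?_, fun y hy h => ⟨?_, fun t => ?_⟩⟩
  · -- joint continuity of the first derivative field
    refine (continuousOn_prod_of_norm_sub_le Λ₁ hΛ₁n hD1c ht1).congr fun q hq => ?_
    dsimp only
    rw [hΛ₁]
    exact fderiv_apply_eq_evalCLM_comp (hGd q.2 hq.2) _
  · -- joint continuity of the second derivative field
    refine (continuousOn_prod_of_norm_sub_le Λ₂ hΛ₂n hD2c fun y hy =>
      (ht2 y hy).mono Ioc_subset_Icc_self).congr fun q hq => ?_
    dsimp only
    rw [hΛ₂]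
    exact fderiv_fderiv_apply_eq_comp hU hG hq.2 _
  · -- continuity in `t` of `D_y[G y (t)] h`
    have heq : (fun t : Icc (0 : ℝ) L => fderiv ℝ (fun y' => G y' t) y h) = fun t => fderiv ℝ G y h t :=
      funext fun t => h1 y hy t h
    rw [heq]
    exact (fderiv ℝ G y h).continuous
  · -- the linearised identity
    simp only [h1 y hy]
    exact hb y hy h t

end Literature.Analysis.UnboundedOperators

end
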